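import Mathlib
import Summits.ValiantsHypothesis.ValiantsHypothesis.Theorems.BarrierLeverPartitionMinorsHitByVPHiddenStatesPencilObstruction

/-!
# Route BarrierLever — item `PartitionMinorsHitByVP` (stmt-ValiantsHypothesis-19717), line `hidden-states`:
# THE PENCIL OBSTRUCTION FOR JOINS — the node's own design format (pieces × state sets)

Helper file (`--supports stmt-ValiantsHypothesis-19717`; cell valiant-natproofs, rung V4, 𝒟-side door (c), registered line
`Cruxes/PartitionMinorsHitByVP/Lines/hidden_states.lean` v8; prover seat val-np-p6 gen 13). Definition-free; closes NO item.

`…PencilObstruction.det_eq_zero_of_pencil` (this seat) is stated for ONE piece. The node `LowerNode.Stmt.universalJoinWideLower` uses JOINS: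
a design `e : Fin r → Fin m × Finset (Fin K)` (piece, state set) and a table `tx : Fin m → Option (Fin K) → Fin h → ℂ` per piece.
`det_eq_zero_of_pencil_join`: if the design is down-closed inside each piece, all members have `≤ t + 1` states, the `(t+1)`-members of
piece `p` only use states from `Q p`, the row family contains a PENCIL `{D ∪ {b} : b ∈ B'}` (`|D| = t`, `B' ∩ D = ∅`) with
`|B'| > Σ_p |Q p|`, and the design has at most as many members with `≤ t` states as there are rows of size `≤ t`, then the
block-additive matrix is singular for EVERY table. So a universal join at `(h, |B_t(h)| + (h − t))` must either carry SURPLUS low members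
(free points, stars) or spread its top members over at least `h − t` (piece, state) pairs — the quantitative form of «bottom-heavy and
spread» behind the cell's design census (memo HOME/val-np-p6/g13/MEMO-valnp6-g13.md §6).

WHAT THIS IS NOT: a necessary condition on designs, not a cell; nothing on crux 14610 or VP ≠ VNP.
-/

set_option linter.dupNamespace false

namespace Summit.ValiantsHypothesis.ValiantsHypothesis.Theorems.BarrierLever.HiddenStates

open Finset

noncomputable section

namespace BallDiag

/-- **THE PENCIL OBSTRUCTION FOR JOINS.** See the module docstring. -/
theorem det_eq_zero_of_pencil_join (h K r t m : ℕ) (tx : Fin m → Option (Fin K) → Fin h → ℂ)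
    (u : Fin r → Finset (Fin h)) (hu : Function.Injective u)
    (e : Fin r → Fin m × Finset (Fin K)) (hdown : ∀ k A, A ⊆ (e k).2 → ∃ k', e k' = ((e k).1, A))
    (htop : ∀ k, ((e k).2).card ≤ t + 1) (Q : Fin m → Finset (Fin K))
    (hQ : ∀ k, ((e k).2).card = t + 1 → (e k).2 ⊆ Q (e k).1)
    (D B' : Finset (Fin h)) (hD : D.card = t) (hB'D : ∀ b ∈ B', b ∉ D) (hQB : ∑ p, (Q p).card < B'.card)
    (hpencil : ∀ b ∈ B', insert b D ∈ Set.range u)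
    (hprofile : (Finset.univ.filter fun k => ((e k).2).card ≤ t).card ≤ (Finset.univ.filter fun i => (u i).card ≤ t).card) :
    (Matrix.of fun i k : Fin r =>
      ∏ a ∈ u i, (tx (e k).1 none a + ∑ q ∈ (e k).2, tx (e k).1 (some q) a)).det = 0 := by
  classical
  -- (1) the pencil coefficients `β`: unknowns `B'`, one equation per (piece, state of Q piece)
  set PQ : Finset ((_ : Fin m) × Fin K) := Finset.univ.sigma Q with hPQ
  let Tm : Matrix ↥PQ ↥B' ℂ := fun x b => tx x.1.1 (some x.1.2) b.1
  have hker : LinearMap.ker Tm.mulVecLin ≠ ⊥ := by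
    apply LinearMap.ker_ne_bot_of_finrank_lt
    rw [Module.finrank_fintype_fun_eq_card, Module.finrank_fintype_fun_eq_card, Fintype.card_coe, Fintype.card_coe, hPQ,
      Finset.card_sigma]
    exact hQB
  obtain ⟨β, hβker, hβne⟩ := (Submodule.ne_bot_iff _).mp hker
  have hβQ : ∀ x : ↥PQ, ∑ b : ↥B', tx x.1.1 (some x.1.2) b.1 * β b = 0 := by
    intro x
    have h1 := congrFun (LinearMap.mem_ker.mp hβker) x
    rw [Matrix.mulVecLin_apply] at h1
    exact h1
  obtain ⟨b₀, hb₀⟩ : ∃ b : ↥B', β b ≠ 0 := by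
    by_contra hno
    push Not at hno
    exact hβne (funext hno)
  let βf : Fin h → ℂ := fun b => if hb : b ∈ B' then β ⟨b, hb⟩ else 0
  have hβf : ∀ b (hb : b ∈ B'), βf b = β ⟨b, hb⟩ := fun b hb => by simp only [βf, dif_pos hb]
  have hμ : ∀ p, ∀ q ∈ Q p, ∑ b ∈ B', βf b * tx p (some q) b = 0 := by
    intro p q hq
    have hx : (⟨p, q⟩ : (_ : Fin m) × Fin K) ∈ PQ := by rw [hPQ, Finset.mem_sigma]; exact ⟨Finset.mem_univ _, hq⟩
    have h1 : ∑ b ∈ B', βf b * tx p (some q) b = ∑ b : ↥B', tx p (some q) b.1 * β b := by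
      rw [Finset.sum_subtype B' (fun _ => Iff.rfl)]
      refine Finset.sum_congr rfl fun b _ => ?_
      have hb := hβf b.1 b.2
      rw [hb]
      ring
    rw [h1]
    exact hβQ ⟨⟨p, q⟩, hx⟩
  -- hidden points, rows, per-piece indicators
  let pt : Fin r → Fin h → ℂ := fun k a => tx (e k).1 none a + ∑ q ∈ (e k).2, tx (e k).1 (some q) a
  let row : Finset (Fin h) → (Fin r → ℂ) := fun S k => ∏ a ∈ S, pt k a
  let ind : Fin m → Finset (Fin K) → (Fin r → ℂ) := fun p A k => if (e k).1 = p ∧ A ⊆ (e k).2 then 1 else 0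
  -- (2) the span of the low member indicators
  let W : Submodule ℂ (Fin r → ℂ) :=
    Submodule.span ℂ (Set.range fun k' : {k' : Fin r // ((e k').2).card ≤ t} => ind (e k'.1).1 (e k'.1).2)
  have hfinW : Module.finrank ℂ ↥W ≤ (Finset.univ.filter fun k => ((e k).2).card ≤ t).card := by
    refine (finrank_range_le_card _).trans ?_
    rw [Fintype.card_subtype]
  have hindW : ∀ p (A : Finset (Fin K)), A.card ≤ t → ind p A ∈ W := by
    intro p A hA
    by_cases hex : ∃ k', e k' = (p, A)
    · obtain ⟨k', hk'⟩ := hex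
      refine Submodule.subset_span ⟨⟨k', by rw [hk']; exact hA⟩, ?_⟩
      simp only [hk']
    · have : ind p A = 0 := by
        funext k
        simp only [ind, Pi.zero_apply]
        rw [if_neg]
        rintro ⟨hpk, hAk⟩
        obtain ⟨k', hk'⟩ := hdown k A hAk
        exact hex ⟨k', by rw [hk', hpk]⟩
      rw [this]
      exact W.zero_mem
  -- per-piece row expansions
  have hexp : ∀ S : Finset (Fin h), ∃ c : Fin m → Finset (Fin K) → ℂ, (∀ p A, S.card < A.card → c p A = 0) ∧
      ∀ k, row S k = ∑ p : Fin m, ∑ A : Finset (Fin K), c p A * ind p A k := by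
    intro S
    have hc := fun p => exists_row_expansion (tx p) S
    choose c hc0 hc1 using hc
    refine ⟨c, hc0, fun k => ?_⟩
    simp only [row, pt, ind]
    rw [hc1 (e k).1 (e k).2, Finset.sum_eq_single_of_mem (e k).1 (Finset.mem_univ _)]
    · refine Finset.sum_congr rfl fun A _ => ?_
      simp only [true_and]
    · intro p _ hp
      refine Finset.sum_eq_zero fun A _ => ?_
      rw [if_neg (fun h' => hp h'.1.symm), mul_zero]
  have hrowW : ∀ S : Finset (Fin h), S.card ≤ t → row S ∈ W := by
    intro S hS
    obtain ⟨c, hc0, hc⟩ := hexp S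
    have hre : row S = ∑ p : Fin m, ∑ A : Finset (Fin K), c p A • ind p A := by
      funext k
      rw [hc k]
      simp only [Finset.sum_apply, Pi.smul_apply, smul_eq_mul]
    rw [hre]
    refine Submodule.sum_mem _ fun p _ => Submodule.sum_mem _ fun A _ => ?_
    by_cases hA : A.card ≤ t
    · exact Submodule.smul_mem _ _ (hindW p A hA)
    · rw [hc0 p A (by omega), zero_smul]
      exact W.zero_mem
  -- the pencil combination `R` is in W
  let R : Fin r → ℂ := fun k => ∑ b ∈ B', βf b * row (insert b D) k
  have hRW : R ∈ W := by
    have hc := fun p => exists_row_expansion (tx p) D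
    choose c hc0 hc1 using hc
    have hRk : ∀ k, R k = (∑ b ∈ B', βf b * tx (e k).1 none b) * ∑ A : Finset (Fin K), c (e k).1 A * (if A ⊆ (e k).2 then 1 else 0)
        + ∑ A : Finset (Fin K), ∑ q : Fin K,
            (c (e k).1 A * ∑ b ∈ B', βf b * tx (e k).1 (some q) b) * (if insert q A ⊆ (e k).2 then 1 else 0) := by
      intro k
      have h1 : ∀ b ∈ B', βf b * row (insert b D) k = βf b * pt k b * ∏ a ∈ D, pt k a := by
        intro b hb
        simp only [row]
        rw [Finset.prod_insert (hB'D b hb), mul_assoc]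
      simp only [R]
      rw [Finset.sum_congr rfl h1, ← Finset.sum_mul]
      have h2 : ∑ b ∈ B', βf b * pt k b
          = ∑ b ∈ B', βf b * tx (e k).1 none b + ∑ q ∈ (e k).2, ∑ b ∈ B', βf b * tx (e k).1 (some q) b := by
        simp only [pt, mul_add, Finset.mul_sum, Finset.sum_add_distrib]
        rw [Finset.sum_comm]
      have h4 : ∏ a ∈ D, pt k a = ∑ A : Finset (Fin K), c (e k).1 A * (if A ⊆ (e k).2 then 1 else 0) := by
        simp only [pt]
        exact hc1 (e k).1 (e k).2
      rw [h2, add_mul, h4]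
      congr 1
      rw [Finset.mul_sum]
      refine Finset.sum_congr rfl fun A _ => ?_
      have h3 : ∀ q : Fin K, (c (e k).1 A * ∑ b ∈ B', βf b * tx (e k).1 (some q) b) * (if insert q A ⊆ (e k).2 then (1 : ℂ) else 0)
          = (if q ∈ (e k).2 then (∑ b ∈ B', βf b * tx (e k).1 (some q) b) * (c (e k).1 A * (if A ⊆ (e k).2 then 1 else 0)) else 0) := by
        intro q
        by_cases hqk : q ∈ (e k).2
        · rw [if_pos hqk]
          have : insert q A ⊆ (e k).2 ↔ A ⊆ (e k).2 := by
            rw [Finset.insert_subset_iff]; exact ⟨fun h' => h'.2, fun h' => ⟨hqk, h'⟩⟩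
          simp only [this]
          ring
        · rw [if_neg hqk, if_neg (fun h' => hqk (h' (Finset.mem_insert_self q A))), mul_zero]
      rw [Finset.sum_congr rfl fun q _ => h3 q, ← Finset.sum_filter, Finset.filter_mem_eq_inter, Finset.univ_inter,
        Finset.sum_mul]
    -- as a combination of indicators: sum over the piece as well
    have hRe : R = ∑ p : Fin m, ((∑ b ∈ B', βf b * tx p none b) • (∑ A : Finset (Fin K), c p A • ind p A)
        + ∑ A : Finset (Fin K), ∑ q : Fin K, (c p A * ∑ b ∈ B', βf b * tx p (some q) b) • ind p (insert q A)) := by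
      funext k
      rw [hRk k, Finset.sum_apply, Finset.sum_eq_single_of_mem (e k).1 (Finset.mem_univ _)]
      · simp only [Pi.add_apply, Pi.smul_apply, Finset.sum_apply, smul_eq_mul, ind, true_and]
      · intro p _ hp
        simp only [Pi.add_apply, Pi.smul_apply, Finset.sum_apply, smul_eq_mul, ind]
        have : ∀ A : Finset (Fin K), (if (e k).1 = p ∧ A ⊆ (e k).2 then (1 : ℂ) else 0) = 0 :=
          fun A => if_neg (fun h' => hp h'.1.symm)
        simp only [this, mul_zero, Finset.sum_const_zero, add_zero]
    rw [hRe]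
    refine Submodule.sum_mem _ fun p _ => W.add_mem (Submodule.smul_mem _ _ (Submodule.sum_mem _ fun A _ => ?_))
      (Submodule.sum_mem _ fun A _ => Submodule.sum_mem _ fun q _ => ?_)
    · by_cases hA : A.card ≤ t
      · exact Submodule.smul_mem _ _ (hindW p A hA)
      · rw [hc0 p A (by omega), zero_smul]; exact W.zero_mem
    · by_cases hA : D.card < A.card
      · rw [hc0 p A hA, zero_mul, zero_smul]; exact W.zero_mem
      by_cases hqA : (insert q A).card ≤ t
      · exact Submodule.smul_mem _ _ (hindW p _ hqA)
      · by_cases hqQ : q ∈ Q p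
        · rw [hμ p q hqQ, mul_zero, zero_smul]; exact W.zero_mem
        · have hzero : ind p (insert q A) = 0 := by
            funext k
            simp only [ind, Pi.zero_apply]
            rw [if_neg]
            rintro ⟨hpk, hsub⟩
            have hle := Finset.card_le_card hsub
            have hcard : ((e k).2).card = t + 1 := by
              have := htop k
              have : (insert q A).card ≤ A.card + 1 := Finset.card_insert_le q A
              omega
            have := hQ k hcard (hsub (Finset.mem_insert_self q A))
            rw [hpk] at this
            exact hqQ this
          rw [hzero, smul_zero]; exact W.zero_mem
  -- (3) too many vectors in W
  let ι := {i : Fin r // (u i).card ≤ t} ⊕ Unit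
  let fam : ι → ↥W := fun x => match x with
    | Sum.inl i => ⟨row (u i.1), hrowW _ i.2⟩
    | Sum.inr _ => ⟨R, hRW⟩
  have hdep : ¬ LinearIndependent ℂ fam := by
    intro hli
    have h1 := hli.fintype_card_le_finrank
    have h2 : Fintype.card ι = (Finset.univ.filter fun i => (u i).card ≤ t).card + 1 := by
      simp only [ι, Fintype.card_sum, Fintype.card_unit, Fintype.card_subtype]
    rw [h2] at h1
    have := hfinW
    omega
  obtain ⟨g, hg, x₀, hx₀⟩ := Fintype.not_linearIndependent_iff.mp hdep
  have hgV : ∑ x : ι, g x • ((fam x : ↥W) : Fin r → ℂ) = 0 := by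
    have := congrArg (fun w : ↥W => (w : Fin r → ℂ)) hg
    simpa only [Submodule.coe_sum, Submodule.coe_smul, Submodule.coe_zero] using this
  -- (4) the left kernel vector
  let low : Fin r → ℂ := fun i => if hi : (u i).card ≤ t then g (Sum.inl ⟨i, hi⟩) else 0
  let pen : Fin r → ℂ := fun i => ∑ b ∈ B', if u i = insert b D then βf b else 0
  let cvec : Fin r → ℂ := fun i => low i + g (Sum.inr ()) * pen i
  have hcardins : ∀ b ∈ B', (insert b D).card = t + 1 := fun b hb => by
    rw [Finset.card_insert_of_notMem (hB'D b hb), hD]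
  have hpen_low : ∀ i, (u i).card ≤ t → pen i = 0 := by
    intro i hi
    refine Finset.sum_eq_zero fun b hb => ?_
    rw [if_neg]
    intro h'
    rw [h', hcardins b hb] at hi
    omega
  have hfib : ∀ b ∈ B', ∀ f : Fin r → ℂ,
      ∑ i, (if u i = insert b D then f i else 0) = ∑ i ∈ Finset.univ.filter (fun i => u i = insert b D), f i := by
    intro b _ f
    rw [Finset.sum_filter]
  have hfib1 : ∀ b ∈ B', ∃ i₀, u i₀ = insert b D ∧ Finset.univ.filter (fun i => u i = insert b D) = {i₀} := by
    intro b hb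
    obtain ⟨i₀, hi₀⟩ := hpencil b hb
    refine ⟨i₀, hi₀, ?_⟩
    ext i
    simp only [Finset.mem_filter, Finset.mem_univ, true_and, Finset.mem_singleton]
    constructor
    · intro hi; exact hu (hi.trans hi₀.symm)
    · rintro rfl; exact hi₀
  have hvec : Matrix.vecMul cvec (Matrix.of fun i k : Fin r =>
      ∏ a ∈ u i, (tx (e k).1 none a + ∑ q ∈ (e k).2, tx (e k).1 (some q) a)) = 0 := by
    funext k
    have hk := congrFun hgV k
    rw [Finset.sum_apply, Pi.zero_apply, Fintype.sum_sum_type] at hk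
    simp only [Pi.smul_apply, smul_eq_mul, Finset.univ_unique, Finset.sum_singleton, PUnit.default_eq_unit] at hk
    rw [Matrix.vecMul, dotProduct, Pi.zero_apply]
    simp only [Matrix.of_apply]
    have hsplit : ∑ i, cvec i * ∏ a ∈ u i, (tx (e k).1 none a + ∑ q ∈ (e k).2, tx (e k).1 (some q) a)
        = ∑ i, low i * row (u i) k + g (Sum.inr ()) * ∑ i, pen i * row (u i) k := by
      simp only [cvec, row, pt, add_mul, Finset.sum_add_distrib, Finset.mul_sum, mul_assoc]
    rw [hsplit]
    have hlow : ∑ i, low i * row (u i) k = ∑ i : {i : Fin r // (u i).card ≤ t}, g (Sum.inl i) * row (u i.1) k := by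
      rw [← Finset.sum_subset (Finset.subset_univ (Finset.univ.filter fun i => (u i).card ≤ t)),
        Finset.sum_subtype (Finset.univ.filter fun i => (u i).card ≤ t) (p := fun i => (u i).card ≤ t)
          (fun i => by simp)]
      · refine Finset.sum_congr rfl fun i _ => ?_
        simp only [low, dif_pos i.2]
      · intro i _ hi
        have hi' : ¬ (u i).card ≤ t := fun h' => hi (Finset.mem_filter.mpr ⟨Finset.mem_univ _, h'⟩)
        simp only [low, dif_neg hi', zero_mul]
    have hpenR : ∑ i, pen i * row (u i) k = R k := by
      simp only [pen, R, Finset.sum_mul]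
      rw [Finset.sum_comm]
      refine Finset.sum_congr rfl fun b hb => ?_
      obtain ⟨i₀, hi₀, hfil⟩ := hfib1 b hb
      have : ∀ i, (if u i = insert b D then βf b else 0) * row (u i) k
          = if u i = insert b D then βf b * row (insert b D) k else 0 := by
        intro i
        by_cases h' : u i = insert b D
        · rw [if_pos h', if_pos h', h']
        · rw [if_neg h', if_neg h', zero_mul]
      rw [Finset.sum_congr rfl fun i _ => this i, hfib b hb, hfil, Finset.sum_singleton]
    rw [hlow, hpenR]
    have hfam : ∀ i : {i : Fin r // (u i).card ≤ t}, ((fam (Sum.inl i) : ↥W) : Fin r → ℂ) k = row (u i.1) k := fun i => rfl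
    have hfamR : ((fam (Sum.inr ()) : ↥W) : Fin r → ℂ) k = R k := rfl
    simp only [hfam, hfamR] at hk
    exact hk
  have hcne : cvec ≠ 0 := by
    intro hc0
    rcases x₀ with i | _
    · have := congrFun hc0 i.1
      simp only [cvec, Pi.zero_apply, hpen_low i.1 i.2, mul_zero, add_zero, low, dif_pos i.2] at this
      exact hx₀ this
    · obtain ⟨i₀, hi₀, hfil⟩ := hfib1 b₀.1 b₀.2
      have := congrFun hc0 i₀
      have hlow0 : low i₀ = 0 := by
        have : ¬ (u i₀).card ≤ t := by rw [hi₀, hcardins b₀.1 b₀.2]; omega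
        simp only [low, dif_neg this]
      have hpen0 : pen i₀ = βf b₀.1 := by
        simp only [pen]
        rw [Finset.sum_eq_single_of_mem b₀.1 b₀.2]
        · rw [if_pos hi₀]
        · intro b hb hne
          rw [if_neg]
          intro h'
          apply hne
          have hmem : b ∈ insert b D := Finset.mem_insert_self b D
          rw [← h', hi₀, Finset.mem_insert] at hmem
          rcases hmem with h'' | h''
          · exact h''
          · exact absurd h'' (hB'D b hb)
      simp only [cvec, Pi.zero_apply, hlow0, zero_add, hpen0, hβf b₀.1 b₀.2] at this
      rcases mul_eq_zero.mp this with h' | h'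
      · exact hx₀ h'
      · exact hb₀ h'
  exact Matrix.exists_vecMul_eq_zero_iff.mp ⟨cvec, hcne, hvec⟩

end BallDiag

end

end Summit.ValiantsHypothesis.ValiantsHypothesis.Theorems.BarrierLever.HiddenStates
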